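import Literature.Probability.RandomPlanarGeometry.SAWTilePolygons
import HarnessLib

/-!
# The merged excursion through the polygons of a connected family of tiles

H. Duminil-Copin, G. Kozma, A. Yadin, *Supercritical self-avoiding walks are space-filling*,
Ann. IHP Probab. Stat. 50 (2014), §3, proof of Proposition 7, Claim: the polygons of `P_m`
placed in the boxes of a connected family `F` are merged, one box at a time along a
connected enumeration of `F`, through facing cardinal edges ("by changing the edges `[cd]` and
`[ab]` of `γ` and `γ'` into the edges `[ac]` and `[bd]`, one obtains a polygon in `S_F` …
the construction is one-to-one and we deduce `Z_{F₀}(x) ≥ Z_{F₀∖{B}}(x) Z_B(x)`").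

Over the odd tiles with margins of `SAWTiles.lean` we build the merged structure directly as
the self-avoiding VERTEX LIST that the surgery inserts into the walk (`OddTile.mergeList`):
start from the polygon of the root tile `t₀` opened at its port facing `d₀`
(`OddTile.openAt`), and for each step `(τ, d)` of a valid attachment sequence
(`OddTile.ValidFrom`: `τ` already in the family, the new tile `τ + d` not yet, and never the
forbidden tile `t₀ + d₀`) splice, between the consecutive port vertices `portA τ d, portB τ d`
of the current list, the connector `connInnerA τ d`, the polygon of `τ + d` opened at its port
facing `τ`, and the connector `connInnerB τ d` backwards (`OddTile.insertFor`, `spliceAt`).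
The invariant `OddTile.MergeInv` records what the surgery and its decoding need: the list is
self-avoiding inside the blob region (inner boxes of the family and connector cells of the
attachments), runs from `portA t₀ d₀` to `portB t₀ d₀`, still exhibits every unused port as a
consecutive pair, has length `Σ_τ #P_τ + (4r+2)·(number of attachments)` (each merge costs
`4r + 2` edges), and its vertices in the inner box of each tile, in order, are exactly that
tile's opened polygon — so the polygons are recovered from the list (`OddTile.mergeFrom_inj`).
-/

noncomputable section

open Finset Literature.Probability.LatticeModels

namespace Literature.Probability.RandomPlanarGeometry.SAW

/-! ### List lemmas: consecutive pairs under append and splice -/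

/-- A consecutive pair of `A ++ B` lies in `A`, in `B`, or straddles the junction. [folklore] -/
theorem infix_pair_append {V : Type*} :
    ∀ {A B : List V} {u₁ u₂ : V}, [u₁, u₂] <:+: A ++ B →
      [u₁, u₂] <:+: A ∨ [u₁, u₂] <:+: B ∨ (A.getLast? = some u₁ ∧ B.head? = some u₂)
  | [], B, u₁, u₂, h => Or.inr (Or.inl (by simpa using h))
  | a :: A, B, u₁, u₂, h => by
    rw [List.cons_append, List.infix_cons_iff] at h
    rcases h with h | h
    · -- prefix: `u₁ = a`
      rw [List.cons_prefix_cons] at h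
      obtain ⟨rfl, h⟩ := h
      cases A with
      | nil =>
        refine Or.inr (Or.inr ⟨by simp, ?_⟩)
        cases B with
        | nil => simp at h
        | cons b B => rw [List.nil_append, List.cons_prefix_cons] at h; simp [h.1]
      | cons a₂ A =>
        rw [List.cons_append, List.cons_prefix_cons] at h
        exact Or.inl ⟨[], A, by simp [h.1]⟩
    · rcases infix_pair_append h with h | h | ⟨h1, h2⟩
      · exact Or.inl (List.infix_cons h)
      · exact Or.inr (Or.inl h)
      · refine Or.inr (Or.inr ⟨?_, h2⟩)
        cases A with
        | nil => simp at h1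
        | cons a₂ A => simpa using h1

/-- A consecutive pair of a list other than the spliced one survives the splice. [folklore] -/
theorem infix_pair_splice {V : Type*} {pre post ins : List V} {x y u₁ u₂ : V}
    (h : [u₁, u₂] <:+: pre ++ x :: y :: post) (hne : ¬(u₁ = x ∧ u₂ = y)) :
    [u₁, u₂] <:+: pre ++ x :: ins ++ y :: post := by
  have h' : [u₁, u₂] <:+: (pre ++ [x]) ++ (y :: post) := by simpa using h
  rcases infix_pair_append h' with h | h | ⟨h1, h2⟩
  · obtain ⟨s, t, hst⟩ := h
    refine ⟨s, t ++ ins ++ y :: post, ?_⟩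
    rw [show pre ++ x :: ins ++ y :: post = (pre ++ [x]) ++ (ins ++ y :: post) by simp, ← hst]
    simp
  · obtain ⟨s, t, hst⟩ := h
    exact ⟨pre ++ x :: ins ++ s, t, by rw [← hst]; simp⟩
  · simp only [List.getLast?_append, List.getLast?_singleton, Option.some_or,
      Option.some.injEq, List.head?_cons] at h1 h2
    exact absurd ⟨h1.symm, h2.symm⟩ hne

/-- Filtering a spliced list whose insert avoids the predicate. [folklore] -/
theorem filter_splice_of_forall_not {V : Type*} {pre post ins : List V} {x y : V} {p : V → Bool}
    (h : ∀ v ∈ ins, p v = false) :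
    (pre ++ x :: ins ++ y :: post).filter p = (pre ++ x :: y :: post).filter p := by
  have : ins.filter p = [] := List.filter_eq_nil_iff.2 (by simpa using h)
  simp [List.filter_append, List.filter_cons, this]

namespace OddTile

variable {m r : ℕ}

/-! ### Attachment steps -/

/-- The tile attached by the step `(τ, d)`: `τ + d`. [cite: DuminilCopinKozmaYadin2014, §3 (adjacent boxes)] -/
def newTile (p : Site 2 × Dir) : Site 2 := p.1 + p.2.vec

/-- Validity of a sequence of attachment steps given the tiles `T` already present and the
forbidden tile `forb`: each step attaches, to a present tile, a tile that is neither present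
nor forbidden. (A connected family admits such a sequence from any of its tiles, by growing a
maximal attachable sub-family.) [cite: DuminilCopinKozmaYadin2014, §3 (proof of the Claim: induction on |F|)] -/
def ValidFrom (forb : Site 2) : List (Site 2) → List (Site 2 × Dir) → Prop
  | _, [] => True
  | T, p :: rest => p.1 ∈ T ∧ newTile p ∉ T ∧ newTile p ≠ forb ∧ ValidFrom forb (T ++ [newTile p]) rest

/-- The tiles present after the steps. [folklore] -/
def tilesAfter (T : List (Site 2)) (steps : List (Site 2 × Dir)) : List (Site 2) :=
  T ++ steps.map newTile

variable (m r) in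
/-- The blob region of a family: the inner boxes of its tiles and the connector cells of its
attachments (where the merged structure lives). [cite: DuminilCopinKozmaYadin2014, §3 (𝓔_F)] -/
def blobRegion (T : List (Site 2)) (C : List (Site 2 × Dir)) : Finset (Site 2) :=
  (T.toFinset.biUnion fun τ => innerBox m r τ) ∪ C.toFinset.biUnion fun p => connCells m r p.1 p.2

/-- Membership in the blob region. [folklore] -/
theorem mem_blobRegion_iff {T : List (Site 2)} {C : List (Site 2 × Dir)} {v : Site 2} :
    v ∈ blobRegion m r T C ↔ (∃ τ ∈ T, v ∈ innerBox m r τ) ∨ ∃ p ∈ C, v ∈ connCells m r p.1 p.2 := by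
  simp [blobRegion]

/-- The blob region grows with the family. [folklore] -/
theorem blobRegion_mono {T T' : List (Site 2)} {C C' : List (Site 2 × Dir)} (hT : T ⊆ T')
    (hC : C ⊆ C') : blobRegion m r T C ⊆ blobRegion m r T' C' := by
  intro v hv
  rw [mem_blobRegion_iff] at hv ⊢
  rcases hv with ⟨τ, hτ, h⟩ | ⟨p, hp, h⟩
  · exact Or.inl ⟨τ, hT hτ, h⟩
  · exact Or.inr ⟨p, hC hp, h⟩

/-- The blob region lies in the tiles of the family (when attachments join present tiles).
[cite: DuminilCopinKozmaYadin2014, §3 (𝓔_F ⊆ V_F)] -/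
theorem exists_mem_tile_of_mem_blobRegion {T : List (Site 2)} {C : List (Site 2 × Dir)}
    (hC : ∀ p ∈ C, p.1 ∈ T ∧ newTile p ∈ T) {v : Site 2} (hv : v ∈ blobRegion m r T C) :
    ∃ τ ∈ T, v ∈ tile m r τ := by
  rw [mem_blobRegion_iff] at hv
  rcases hv with ⟨τ, hτ, h⟩ | ⟨p, hp, h⟩
  · exact ⟨τ, hτ, innerBox_subset_tile τ h⟩
  · rcases mem_tile_of_mem_connCells h with h | h
    · exact ⟨p.1, (hC p hp).1, h⟩
    · exact ⟨newTile p, (hC p hp).2, h⟩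

/-! ### The inserted stretch of one attachment -/

variable (m r) in
/-- The stretch inserted by the step `(τ, d)` between `portA τ d` and `portB τ d`: the connector
`connInnerA τ d`, the polygon of the new tile opened at its port facing `τ`, the connector
`connInnerB τ d` backwards. [cite: DuminilCopinKozmaYadin2014, §3 (proof of the Claim)] -/
def insertFor (P : Site 2 → Finset (Sym2 (Site 2))) (p : Site 2 × Dir) : List (Site 2) :=
  connInnerA m r p.1 p.2 ++ openAt m r (newTile p) p.2.neg (P (newTile p)) ++
    (connInnerB m r p.1 p.2).reverse

/-- Length of the inserted stretch: `#P + 4r + 2` vertices. [cite: DuminilCopinKozmaYadin2014, §3 (each merge through the moats costs 4r+2 edges)] -/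
theorem length_insertFor {P : Site 2 → Finset (Sym2 (Site 2))} {p : Site 2 × Dir}
    (hP : P (newTile p) ∈ tilePolygons m r (newTile p)) :
    (insertFor m r P p).length = (P (newTile p)).card + (4 * r + 2) := by
  rw [insertFor, List.length_append, List.length_append, List.length_reverse, connInnerA,
    connInnerB, length_seg, length_seg, (openAt_spec hP).2.2.2.2.1]
  ring

/-- Vertices of the inserted stretch: connector cells or the inner box of the new tile. [folklore] -/
theorem mem_insertFor_iff {P : Site 2 → Finset (Sym2 (Site 2))} {p : Site 2 × Dir} {v : Site 2} :
    v ∈ insertFor m r P p ↔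
      v ∈ connCells m r p.1 p.2 ∨ v ∈ openAt m r (newTile p) p.2.neg (P (newTile p)) := by
  rw [insertFor, List.mem_append, List.mem_append, List.mem_reverse, mem_connCells_iff]
  tauto

/-- The inserted stretch lies in the blob region of the enlarged family. [folklore] -/
theorem insertFor_subset_blobRegion {P : Site 2 → Finset (Sym2 (Site 2))} {p : Site 2 × Dir}
    (hP : P (newTile p) ∈ tilePolygons m r (newTile p)) {T : List (Site 2)}
    {C : List (Site 2 × Dir)} (hT : newTile p ∈ T) (hC : p ∈ C) {v : Site 2}
    (hv : v ∈ insertFor m r P p) : v ∈ blobRegion m r T C := by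
  rw [mem_blobRegion_iff]
  rcases mem_insertFor_iff.1 hv with h | h
  · exact Or.inr ⟨p, hC, h⟩
  · exact Or.inl ⟨newTile p, hT, mem_innerBox_of_mem_openAt hP h⟩

/-- The inserted stretch visits no vertex twice. [folklore] -/
theorem nodup_insertFor {P : Site 2 → Finset (Sym2 (Site 2))} {p : Site 2 × Dir}
    (hP : P (newTile p) ∈ tilePolygons m r (newTile p)) : (insertFor m r P p).Nodup := by
  rw [insertFor, List.nodup_append, List.nodup_append]
  refine ⟨⟨nodup_connInnerA _ _, (openAt_spec hP).2.1, fun a ha b hb hab => ?_⟩,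
    List.nodup_reverse.2 (nodup_connInnerB _ _), fun a ha b hb hab => ?_⟩
  · subst hab
    exact not_mem_innerBox_of_mem_connCells (mem_connCells_iff.2 (Or.inl ha)) _
      (mem_innerBox_of_mem_openAt hP hb)
  · subst hab
    rw [List.mem_reverse] at hb
    rcases List.mem_append.1 ha with ha | ha
    · exact disjoint_connInnerA_connInnerB _ _ ha hb
    · exact not_mem_innerBox_of_mem_connCells (mem_connCells_iff.2 (Or.inr hb)) _
        (mem_innerBox_of_mem_openAt hP ha)

/-- Between the two port vertices the inserted stretch is a chain of adjacent sites.
[cite: DuminilCopinKozmaYadin2014, §3 (proof of the Claim: the edges [ac] and [bd])] -/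
theorem isChain_insertFor {P : Site 2 → Finset (Sym2 (Site 2))} {p : Site 2 × Dir}
    (hP : P (newTile p) ∈ tilePolygons m r (newTile p)) :
    (portA m r p.1 p.2 :: insertFor m r P p ++ [portB m r p.1 p.2]).IsChain (zdGraph 2).Adj := by
  obtain ⟨τ, d⟩ := p
  set O := openAt m r (newTile (τ, d)) d.neg (P (newTile (τ, d))) with hO
  have hspec := openAt_spec (d := d.neg) hP
  -- `O = a' :: tl` and `O = init ++ [b']`
  obtain ⟨tl, htl⟩ := List.head?_eq_some_iff.1 hspec.2.2.1
  obtain ⟨init, hinit⟩ := List.getLast?_eq_some_iff.1 hspec.2.2.2.1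
  have hA : (portA m r τ d :: connInnerA m r τ d ++ [portA m r (newTile (τ, d)) d.neg]).IsChain
      (zdGraph 2).Adj := by
    have := isChain_seg (portA m r τ d) (Dir.adj_zero_vec d) (2 * r + 2)
    rw [← connA, connA_eq] at this
    simpa [newTile] using this
  have hB : (portB m r (newTile (τ, d)) d.neg :: (connInnerB m r τ d).reverse ++ [portB m r τ d]).IsChain
      (zdGraph 2).Adj := by
    have := isChain_seg (portB m r τ d) (Dir.adj_zero_vec d) (2 * r + 2)
    rw [← connB, connB_eq] at this
    have hrev := List.isChain_reverse.2 (this.imp fun _ _ h => h.symm)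
    simpa [newTile, List.reverse_append] using hrev
  -- glue at `a'`
  have h1 : ((portA m r τ d :: connInnerA m r τ d) ++ O).IsChain (zdGraph 2).Adj := by
    have := List.IsChain.append_overlap (l₁ := portA m r τ d :: connInnerA m r τ d)
      (l₂ := [portA m r (newTile (τ, d)) d.neg]) (l₃ := tl) (by simpa using hA)
      (by rw [List.singleton_append, ← htl]; exact hspec.1) (by simp)
    rw [hO, htl]; simpa using this
  -- glue at `b'`
  have h2 : ((portA m r τ d :: connInnerA m r τ d) ++ O ++
      ((connInnerB m r τ d).reverse ++ [portB m r τ d])).IsChain (zdGraph 2).Adj := by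
    have := List.IsChain.append_overlap
      (l₁ := (portA m r τ d :: connInnerA m r τ d) ++ init)
      (l₂ := [portB m r (newTile (τ, d)) d.neg])
      (l₃ := (connInnerB m r τ d).reverse ++ [portB m r τ d])
      (by rw [List.append_assoc, ← hinit, ← hO]; exact h1) (by simpa using hB) (by simp)
    rw [hO, hinit]; simpa using this
  simpa [insertFor, hO] using h2

/-! ### The merged list -/

variable (m r) in
/-- One attachment: splice the stretch of the step between its two port vertices.
[cite: DuminilCopinKozmaYadin2014, §3 (proof of the Claim)] -/
def mergeStep (P : Site 2 → Finset (Sym2 (Site 2))) (S : List (Site 2)) (p : Site 2 × Dir) :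
    List (Site 2) :=
  spliceAt S (portA m r p.1 p.2) (portB m r p.1 p.2) (insertFor m r P p)

variable (m r) in
/-- The merged list after a sequence of attachments, starting from the list `S`.
[cite: DuminilCopinKozmaYadin2014, §3 (proof of the Claim: induction on |F|)] -/
def mergeFrom (P : Site 2 → Finset (Sym2 (Site 2))) : List (Site 2) → List (Site 2 × Dir) → List (Site 2)
  | S, [] => S
  | S, p :: rest => mergeFrom P (mergeStep m r P S p) rest

/-- No step: the list is unchanged. [folklore] -/
@[simp] theorem mergeFrom_nil (P : Site 2 → Finset (Sym2 (Site 2))) (S : List (Site 2)) :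
    mergeFrom m r P S [] = S := rfl

/-- One more step. [folklore] -/
@[simp] theorem mergeFrom_cons (P : Site 2 → Finset (Sym2 (Site 2))) (S : List (Site 2))
    (p : Site 2 × Dir) (rest : List (Site 2 × Dir)) :
    mergeFrom m r P S (p :: rest) = mergeFrom m r P (mergeStep m r P S p) rest := rfl

variable (m r) in
/-- **The merged excursion** of the family grown from the root tile `t₀` (its polygon opened at
the port facing `d₀`) by the attachment steps: a vertex list from `portA t₀ d₀` to
`portB t₀ d₀`. [cite: DuminilCopinKozmaYadin2014, §3 (S_F)] -/
def mergeList (P : Site 2 → Finset (Sym2 (Site 2))) (t₀ : Site 2) (d₀ : Dir)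
    (steps : List (Site 2 × Dir)) : List (Site 2) :=
  mergeFrom m r P (openAt m r t₀ d₀ (P t₀)) steps

/-! ### The invariant -/

variable (m r) in
/-- The invariant of the merging construction for the (tile, entry-side) list `TD` (root
`(t₀, d₀)` and attached tiles with the side facing their parent), the attachments `C` and the
current list `S`. [cite: DuminilCopinKozmaYadin2014, §3 (proof of the Claim)] -/
structure MergeInv (P : Site 2 → Finset (Sym2 (Site 2))) (t₀ : Site 2) (d₀ : Dir)
    (TD : List (Site 2 × Dir)) (C : List (Site 2 × Dir)) (S : List (Site 2)) : Prop where
  /-- self-avoiding inside the blob region -/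
  saw : IsSAWList (zdGraph 2) (blobRegion m r (TD.map Prod.fst) C) S
  /-- starts at the root port -/
  head : S.head? = some (portA m r t₀ d₀)
  /-- ends at the root port -/
  last : S.getLast? = some (portB m r t₀ d₀)
  /-- unused ports are still consecutive pairs -/
  avail : ∀ q ∈ TD, ∀ d : Dir, q.1 + d.vec ∉ TD.map Prod.fst → q.1 + d.vec ≠ t₀ + d₀.vec →
    ([portA m r q.1 d, portB m r q.1 d] <:+: S ∨ [portB m r q.1 d, portA m r q.1 d] <:+: S)
  /-- each merge costs `4r + 2` edges -/
  len : S.length = (TD.map fun q => (P q.1).card).sum + (4 * r + 2) * C.length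
  /-- the vertices in the inner box of a tile are its opened polygon, in order (either way) -/
  filt : ∀ q ∈ TD, S.filter (fun v => decide (v ∈ innerBox m r q.1)) = openAt m r q.1 q.2 (P q.1) ∨
    S.filter (fun v => decide (v ∈ innerBox m r q.1)) = (openAt m r q.1 q.2 (P q.1)).reverse
  /-- tiles are distinct -/
  nodupT : (TD.map Prod.fst).Nodup
  /-- attachments join tiles of the family -/
  connT : ∀ p ∈ C, p.1 ∈ TD.map Prod.fst ∧ newTile p ∈ TD.map Prod.fst
  /-- entry sides of attached tiles face their parents -/
  entryT : ∀ q ∈ TD, q ≠ (t₀, d₀) → q.1 + q.2.vec ∈ TD.map Prod.fst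
  /-- the root is listed -/
  root : (t₀, d₀) ∈ TD
  /-- the forbidden tile is never attached -/
  forb : t₀ + d₀.vec ∉ TD.map Prod.fst

/-- The invariant holds for the root alone. [cite: DuminilCopinKozmaYadin2014, §3 (proof of the Claim, |F| = 1)] -/
theorem MergeInv.init {P : Site 2 → Finset (Sym2 (Site 2))} {t₀ : Site 2} {d₀ : Dir}
    (hP : P t₀ ∈ tilePolygons m r t₀) :
    MergeInv m r P t₀ d₀ [(t₀, d₀)] [] (openAt m r t₀ d₀ (P t₀)) := by
  have hspec := openAt_spec (d := d₀) hP
  refine ⟨⟨openAt_ne_nil hP, hspec.1, hspec.2.1, fun w hw => ?_⟩, hspec.2.2.1, hspec.2.2.2.1,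
    ?_, ?_, ?_, by simp, by simp, ?_, by simp, ?_⟩
  · rw [mem_blobRegion_iff]
    exact Or.inl ⟨t₀, by simp, mem_innerBox_of_mem_openAt hP hw⟩
  · intro q hq d _ hne
    simp only [List.mem_singleton] at hq
    subst hq
    have hd : d ≠ d₀ := fun h => hne (by rw [h])
    exact port_infix_openAt hP hd
  · simp [hspec.2.2.2.2.1]
  · intro q hq
    simp only [List.mem_singleton] at hq
    subst hq
    exact Or.inl (List.filter_eq_self.2 fun v hv => by simpa using mem_innerBox_of_mem_openAt hP hv)
  · intro q hq hne
    simp only [List.mem_singleton] at hq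
    exact absurd hq hne
  · simp only [List.map_cons, List.map_nil, List.mem_singleton]
    intro h
    exact Dir.vec_ne_zero d₀ (by simpa using h.symm)

/-! ### One attachment preserves the invariant -/

/-- Filtering a spliced list all of whose old vertices fail the predicate. [folklore] -/
theorem filter_splice_eq_of_forall_not {V : Type*} {pre post J : List V} {a b : V} {p : V → Bool}
    (h : ∀ v ∈ pre ++ a :: b :: post, p v = false) :
    (pre ++ a :: J ++ b :: post).filter p = J.filter p := by
  have hpre : pre.filter p = [] := List.filter_eq_nil_iff.2 (by
    intro v hv; simpa using h v (by simp [hv]))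
  have hpost : post.filter p = [] := List.filter_eq_nil_iff.2 (by
    intro v hv; simpa using h v (by simp [hv]))
  have ha : p a = false := h a (by simp)
  have hb : p b = false := h b (by simp)
  simp [List.filter_append, hpre, hpost, ha, hb]

/-- Consecutive pairs of a reversed list, as a set of edges. [folklore] -/
theorem pairEdges_reverse_toFinset {V : Type*} [DecidableEq V] (l : List V) :
    (pairEdges l.reverse).toFinset = (pairEdges l).toFinset := by
  ext e
  simp only [List.mem_toFinset, mem_pairEdges_iff]
  constructor
  · rintro ⟨x, y, rfl, h⟩
    refine ⟨y, x, Sym2.eq_swap, ?_⟩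
    rw [← List.reverse_infix]; simpa using h
  · rintro ⟨x, y, rfl, h⟩
    refine ⟨y, x, Sym2.eq_swap, ?_⟩
    rw [← List.reverse_infix]; simpa using h

/-- Connector cells of a new attachment avoid those of the earlier attachments (which join two
tiles of the family, while the new attachment brings in a new tile). [folklore] -/
theorem disjoint_connCells_of_family {T : List (Site 2)} {p p' : Site 2 × Dir}
    (hp2 : newTile p ∉ T) (hp'1 : p'.1 ∈ T) (hp'2 : newTile p' ∈ T) :
    Disjoint (connCells m r p.1 p.2) (connCells m r p'.1 p'.2) := by
  rw [Finset.disjoint_left]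
  intro w hw hw'
  have ht := mem_tile_of_mem_connCells hw
  have ht' := mem_tile_of_mem_connCells hw'
  simp only [mem_tile_iff_tileOf_eq] at ht ht'
  rcases ht with ht | ht <;> rcases ht' with ht' | ht'
  · -- same first tile: different sides
    have h11 : p.1 = p'.1 := ht.symm.trans ht'
    have hd : p.2 ≠ p'.2 := by
      intro hd
      apply hp2
      rw [show newTile p = newTile p' by rw [newTile, newTile, h11, hd]]
      exact hp'2
    rw [h11] at hw
    exact Finset.disjoint_left.1 (disjoint_connCells_of_ne p'.1 hd) hw hw'
  · -- `p.1` is the new tile of `p'`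
    have h11 : p.1 = newTile p' := ht.symm.trans ht'
    rw [connCells_eq_neg p'.1] at hw'
    have hd : p.2 ≠ p'.2.neg := by
      intro hd
      apply hp2
      have : newTile p = p'.1 := by
        rw [newTile, h11, hd, newTile, Dir.vec_neg, add_neg_cancel_right]
      rw [this]; exact hp'1
    rw [h11] at hw
    exact Finset.disjoint_left.1 (disjoint_connCells_of_ne (newTile p') hd) hw hw'
  · exact hp2 (show newTile p ∈ T by rw [newTile, ht.symm.trans ht']; exact hp'1)
  · exact hp2 (show newTile p ∈ T by rw [newTile, ht.symm.trans ht']; exact hp'2)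

/-- The inserted stretch of a valid attachment is disjoint from the blob region of the family.
[folklore] -/
theorem insertFor_fresh {P : Site 2 → Finset (Sym2 (Site 2))} {p : Site 2 × Dir}
    (hP : P (newTile p) ∈ tilePolygons m r (newTile p)) {T : List (Site 2)}
    {C : List (Site 2 × Dir)} (hp2 : newTile p ∉ T)
    (hC : ∀ p' ∈ C, p'.1 ∈ T ∧ newTile p' ∈ T) {w : Site 2} (hw : w ∈ insertFor m r P p) :
    w ∉ blobRegion m r T C := by
  rw [mem_blobRegion_iff]
  rcases mem_insertFor_iff.1 hw with hw | hw
  · rintro (⟨τ, -, hτ⟩ | ⟨p', hp', hw'⟩)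
    · exact not_mem_innerBox_of_mem_connCells hw τ hτ
    · exact Finset.disjoint_left.1 (disjoint_connCells_of_family hp2 (hC p' hp').1 (hC p' hp').2)
        hw hw'
  · have hwI := mem_innerBox_of_mem_openAt hP hw
    rintro (⟨τ, hτT, hτ⟩ | ⟨p', -, hw'⟩)
    · have : τ = newTile p :=
        (mem_tile_iff_tileOf_eq.1 (innerBox_subset_tile τ hτ)).symm.trans
          (mem_tile_iff_tileOf_eq.1 (innerBox_subset_tile _ hwI))
      exact hp2 (this ▸ hτT)
    · exact not_mem_innerBox_of_mem_connCells hw' _ hwI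

/-- The inserted stretch has no vertex in the inner box of a tile of the family. [folklore] -/
theorem insertFor_not_mem_innerBox {P : Site 2 → Finset (Sym2 (Site 2))} {p : Site 2 × Dir}
    (hP : P (newTile p) ∈ tilePolygons m r (newTile p)) {τ : Site 2} (hτ : τ ≠ newTile p)
    {w : Site 2} (hw : w ∈ insertFor m r P p) : w ∉ innerBox m r τ := by
  intro hwτ
  rcases mem_insertFor_iff.1 hw with hw | hw
  · exact not_mem_innerBox_of_mem_connCells hw τ hwτ
  · have hwI := mem_innerBox_of_mem_openAt hP hw
    exact hτ ((mem_tile_iff_tileOf_eq.1 (innerBox_subset_tile τ hwτ)).symm.trans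
      (mem_tile_iff_tileOf_eq.1 (innerBox_subset_tile _ hwI)))

/-- The vertices of the inserted stretch in the inner box of the new tile are its opened
polygon. [folklore] -/
theorem filter_insertFor {P : Site 2 → Finset (Sym2 (Site 2))} {p : Site 2 × Dir}
    (hP : P (newTile p) ∈ tilePolygons m r (newTile p)) :
    (insertFor m r P p).filter (fun v => decide (v ∈ innerBox m r (newTile p))) =
      openAt m r (newTile p) p.2.neg (P (newTile p)) := by
  rw [insertFor, List.filter_append, List.filter_append, List.filter_reverse]
  have hA : (connInnerA m r p.1 p.2).filter (fun v => decide (v ∈ innerBox m r (newTile p))) = [] :=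
    List.filter_eq_nil_iff.2 fun v hv => by
      simpa using not_mem_innerBox_of_mem_connCells (mem_connCells_iff.2 (Or.inl hv)) (newTile p)
  have hB : (connInnerB m r p.1 p.2).filter (fun v => decide (v ∈ innerBox m r (newTile p))) = [] :=
    List.filter_eq_nil_iff.2 fun v hv => by
      simpa using not_mem_innerBox_of_mem_connCells (mem_connCells_iff.2 (Or.inr hv)) (newTile p)
  rw [hA, hB, List.filter_eq_self.2 fun v hv => by simpa using mem_innerBox_of_mem_openAt hP hv]
  simp

/-- Port pairs of different (tile, side) data are different edges. [folklore] -/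
theorem port_pair_ne_of_ne {τ τ' : Site 2} {d d' : Dir} (h : (τ, d) ≠ (τ', d')) :
    s(portA m r τ d, portB m r τ d) ≠ s(portA m r τ' d', portB m r τ' d') := by
  by_cases hτ : τ = τ'
  · subst hτ
    have hd : d ≠ d' := fun hd => h (by rw [hd])
    exact port_pair_ne hd
  · intro heq
    have hA : portA m r τ d ∈ s(portA m r τ' d', portB m r τ' d') := heq ▸ Sym2.mem_mk_left _ _
    have hin : portA m r τ d ∈ innerBox m r τ' := by
      rcases Sym2.mem_iff.1 hA with h' | h'
      · rw [h']; exact portA_mem_innerBox τ' d'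
      · rw [h']; exact portB_mem_innerBox τ' d'
    exact hτ ((mem_tile_iff_tileOf_eq.1 (innerBox_subset_tile τ (portA_mem_innerBox τ d))).symm.trans
      (mem_tile_iff_tileOf_eq.1 (innerBox_subset_tile τ' hin)))

/-- **One attachment preserves the invariant**, given the decomposition of the current list at
the port pair of the step (in either orientation) and the stretch `J` inserted there (the
stretch of the step or its reverse). [cite: DuminilCopinKozmaYadin2014, §3 (proof of the Claim: induction step)] -/
theorem MergeInv.step_of_decomp {P : Site 2 → Finset (Sym2 (Site 2))} {t₀ : Site 2} {d₀ : Dir}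
    {TD C : List (Site 2 × Dir)} {S : List (Site 2)} (hI : MergeInv m r P t₀ d₀ TD C S)
    {p : Site 2 × Dir} (hp1 : p.1 ∈ TD.map Prod.fst) (hp2 : newTile p ∉ TD.map Prod.fst)
    (hp3 : newTile p ≠ t₀ + d₀.vec) (hP : P (newTile p) ∈ tilePolygons m r (newTile p))
    {pre post J : List (Site 2)} {a b : Site 2} (hS : S = pre ++ a :: b :: post)
    (hab : s(a, b) = s(portA m r p.1 p.2, portB m r p.1 p.2))
    (hJmem : ∀ w, w ∈ J ↔ w ∈ insertFor m r P p) (hJnodup : J.Nodup)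
    (hJchain : (a :: J ++ [b]).IsChain (zdGraph 2).Adj)
    (hJlen : J.length = (insertFor m r P p).length)
    (hJfilt : J.filter (fun v => decide (v ∈ innerBox m r (newTile p))) =
        openAt m r (newTile p) p.2.neg (P (newTile p)) ∨
      J.filter (fun v => decide (v ∈ innerBox m r (newTile p))) =
        (openAt m r (newTile p) p.2.neg (P (newTile p))).reverse)
    (hJport : ∀ d' : Dir, d' ≠ p.2.neg →
      [portA m r (newTile p) d', portB m r (newTile p) d'] <:+: J ∨
        [portB m r (newTile p) d', portA m r (newTile p) d'] <:+: J) :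
    MergeInv m r P t₀ d₀ (TD ++ [(newTile p, p.2.neg)]) (C ++ [p]) (pre ++ a :: J ++ b :: post) := by
  have hTD' : (TD ++ [(newTile p, p.2.neg)]).map Prod.fst = TD.map Prod.fst ++ [newTile p] := by simp
  have hCsub : C ⊆ C ++ [p] := List.subset_append_left _ _
  have hTsub : TD.map Prod.fst ⊆ (TD ++ [(newTile p, p.2.neg)]).map Prod.fst := by
    rw [hTD']; exact List.subset_append_left _ _
  have hfresh : ∀ w ∈ J, w ∉ pre ++ a :: b :: post := fun w hw => by
    rw [← hS]
    exact fun hwS => insertFor_fresh hP hp2 hI.connT ((hJmem w).1 hw) (hI.saw.subset w hwS)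
  have hJD : ∀ w ∈ J, w ∈ blobRegion m r ((TD ++ [(newTile p, p.2.neg)]).map Prod.fst) (C ++ [p]) :=
    fun w hw => insertFor_subset_blobRegion hP (by simp) (by simp) ((hJmem w).1 hw)
  refine ⟨?_, ?_, ?_, ?_, ?_, ?_, ?_, ?_, ?_, ?_, ?_⟩
  · -- self-avoiding
    have h0 : IsSAWList (zdGraph 2)
        (blobRegion m r ((TD ++ [(newTile p, p.2.neg)]).map Prod.fst) (C ++ [p]))
        (pre ++ a :: [] ++ b :: post) := by
      simpa [← hS] using hI.saw.mono (blobRegion_mono hTsub hCsub)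
    exact h0.splice hJchain hJnodup (by simpa using hfresh) hJD
  · rw [head?_splice pre [] J post a b, ← hI.head, hS]; simp
  · rw [getLast?_splice pre [] J post a b, ← hI.last, hS]; simp
  · -- unused ports stay consecutive
    intro q hq d' hq1 hq2
    rw [hTD'] at hq1
    rcases List.mem_append.1 hq with hq | hq
    · have hold := hI.avail q hq d' (fun h => hq1 (List.mem_append_left _ h)) hq2
      rw [hS] at hold
      have hne : (q.1, d') ≠ (p.1, p.2) := by
        intro h
        simp only [Prod.mk.injEq] at h
        apply hq1
        rw [h.1, h.2]
        exact List.mem_append_right _ (by simp [newTile])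
      have hpair := port_pair_ne_of_ne (m := m) (r := r) hne
      rcases hold with hold | hold
      · refine Or.inl (infix_pair_splice hold fun h => hpair ?_)
        rw [h.1, h.2]; exact hab
      · refine Or.inr (infix_pair_splice hold fun h => hpair ?_)
        rw [h.1, h.2, Sym2.eq_swap]; exact hab
    · simp only [List.mem_singleton] at hq
      subst hq
      have hd' : d' ≠ p.2.neg := by
        intro h
        apply hq1
        subst h
        simp only [newTile, Dir.vec_neg, add_neg_cancel_right]
        exact List.mem_append_left _ hp1
      have hJinf : J <:+: pre ++ a :: J ++ b :: post := ⟨pre ++ [a], b :: post, by simp⟩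
      rcases hJport d' hd' with h | h
      · exact Or.inl (h.trans hJinf)
      · exact Or.inr (h.trans hJinf)
  · -- length
    have hl : (pre ++ a :: J ++ b :: post).length = S.length + J.length := by
      rw [hS]; simp only [List.length_append, List.length_cons]; omega
    rw [hl, hI.len, hJlen, length_insertFor hP]
    simp only [List.map_append, List.map_cons, List.map_nil, List.sum_append, List.sum_cons,
      List.sum_nil, add_zero, List.length_append, List.length_singleton]
    ring
  · -- filters
    intro q hq
    rcases List.mem_append.1 hq with hq | hq
    · have hne : q.1 ≠ newTile p := fun h => hp2 (h ▸ List.mem_map_of_mem (f := Prod.fst) hq)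
      rw [filter_splice_of_forall_not (fun v hv => by
        simpa using insertFor_not_mem_innerBox hP hne ((hJmem v).1 hv)), ← hS]
      exact hI.filt q hq
    · simp only [List.mem_singleton] at hq
      subst hq
      have hold : ∀ v ∈ pre ++ a :: b :: post, decide (v ∈ innerBox m r (newTile p)) = false := by
        intro v hv
        rw [← hS] at hv
        have hvR := hI.saw.subset v hv
        simp only [decide_eq_false_iff_not]
        intro hvI
        rw [mem_blobRegion_iff] at hvR
        rcases hvR with ⟨τ, hτT, hτ⟩ | ⟨p', -, hw'⟩
        · have : τ = newTile p :=
            (mem_tile_iff_tileOf_eq.1 (innerBox_subset_tile τ hτ)).symm.trans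
              (mem_tile_iff_tileOf_eq.1 (innerBox_subset_tile _ hvI))
          exact hp2 (this ▸ hτT)
        · exact not_mem_innerBox_of_mem_connCells hw' _ hvI
      rw [filter_splice_eq_of_forall_not hold]
      simpa only using hJfilt
  · rw [hTD', List.nodup_append]
    exact ⟨hI.nodupT, by simp, fun x hx y hy hxy => hp2 (by simp only [List.mem_singleton] at hy; rwa [← hy, ← hxy])⟩
  · intro p' hp'
    rw [hTD']
    rcases List.mem_append.1 hp' with hp' | hp'
    · exact ⟨List.mem_append_left _ (hI.connT p' hp').1, List.mem_append_left _ (hI.connT p' hp').2⟩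
    · simp only [List.mem_singleton] at hp'
      subst hp'
      exact ⟨List.mem_append_left _ hp1, by simp⟩
  · intro q hq hne
    rw [hTD']
    rcases List.mem_append.1 hq with hq | hq
    · exact List.mem_append_left _ (hI.entryT q hq hne)
    · simp only [List.mem_singleton] at hq
      subst hq
      simp only [newTile, Dir.vec_neg, add_neg_cancel_right]
      exact List.mem_append_left _ hp1
  · exact List.mem_append_left _ hI.root
  · rw [hTD', List.mem_append, not_or]
    exact ⟨hI.forb, by simpa using fun h => hp3 h.symm⟩

/-- **One attachment preserves the invariant.** [cite: DuminilCopinKozmaYadin2014, §3 (proof of the Claim: induction step)] -/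
theorem MergeInv.step {P : Site 2 → Finset (Sym2 (Site 2))} {t₀ : Site 2} {d₀ : Dir}
    {TD C : List (Site 2 × Dir)} {S : List (Site 2)} (hI : MergeInv m r P t₀ d₀ TD C S)
    {p : Site 2 × Dir} (hp1 : p.1 ∈ TD.map Prod.fst) (hp2 : newTile p ∉ TD.map Prod.fst)
    (hp3 : newTile p ≠ t₀ + d₀.vec) (hP : P (newTile p) ∈ tilePolygons m r (newTile p)) :
    MergeInv m r P t₀ d₀ (TD ++ [(newTile p, p.2.neg)]) (C ++ [p]) (mergeStep m r P S p) := by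
  obtain ⟨q, hq, hq1⟩ := List.mem_map.1 hp1
  have havail := hI.avail q hq p.2 (by rw [hq1]; exact hp2) (by rw [hq1]; exact hp3)
  rw [hq1] at havail
  have hnd := hI.saw.nodup
  have hport := fun d' (hd' : d' ≠ p.2.neg) => port_infix_openAt (m := m) (r := r) (d := p.2.neg) hP hd'
  rcases havail with h | h
  · obtain ⟨pre, post, hst⟩ := h
    have hS : S = pre ++ portA m r p.1 p.2 :: portB m r p.1 p.2 :: post := by rw [← hst]; simp
    rw [mergeStep, spliceAt_eq_of_eq_append hnd hS]
    refine hI.step_of_decomp hp1 hp2 hp3 hP hS rfl (fun w => Iff.rfl) (nodup_insertFor hP)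
      (isChain_insertFor hP) rfl (Or.inl (filter_insertFor hP)) fun d' hd' => ?_
    have hO : openAt m r (newTile p) p.2.neg (P (newTile p)) <:+: insertFor m r P p :=
      ⟨connInnerA m r p.1 p.2, (connInnerB m r p.1 p.2).reverse, by simp [insertFor]⟩
    rcases hport d' hd' with h | h
    · exact Or.inl (h.trans hO)
    · exact Or.inr (h.trans hO)
  · obtain ⟨pre, post, hst⟩ := h
    have hS : S = pre ++ portB m r p.1 p.2 :: portA m r p.1 p.2 :: post := by rw [← hst]; simp
    rw [mergeStep, spliceAt_eq_of_eq_append' hnd hS]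
    refine hI.step_of_decomp hp1 hp2 hp3 hP hS Sym2.eq_swap (fun w => List.mem_reverse)
      (List.nodup_reverse.2 (nodup_insertFor hP)) ?_ (List.length_reverse) ?_ fun d' hd' => ?_
    · have := List.isChain_reverse.2 ((isChain_insertFor hP).imp fun _ _ h => h.symm)
      simpa [List.reverse_append] using this
    · right
      rw [List.filter_reverse, filter_insertFor hP]
    · have hO : (openAt m r (newTile p) p.2.neg (P (newTile p))).reverse <:+: (insertFor m r P p).reverse :=
        List.reverse_infix.2 ⟨connInnerA m r p.1 p.2, (connInnerB m r p.1 p.2).reverse, by simp [insertFor]⟩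
      rcases hport d' hd' with h | h
      · right
        have h' : [portB m r (newTile p) d', portA m r (newTile p) d'] <:+:
            (openAt m r (newTile p) p.2.neg (P (newTile p))).reverse := by
          rw [← List.reverse_infix]; simpa using h
        exact h'.trans hO
      · left
        have h' : [portA m r (newTile p) d', portB m r (newTile p) d'] <:+:
            (openAt m r (newTile p) p.2.neg (P (newTile p))).reverse := by
          rw [← List.reverse_infix]; simpa using h
        exact h'.trans hO

/-! ### The invariant along a valid sequence of attachments -/

/-- **The merging construction satisfies the invariant** along any valid attachment sequence.
[cite: DuminilCopinKozmaYadin2014, §3 (proof of the Claim: induction on |F|)] -/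
theorem MergeInv.mergeFrom {P : Site 2 → Finset (Sym2 (Site 2))} {t₀ : Site 2} {d₀ : Dir} :
    ∀ (steps : List (Site 2 × Dir)) {TD C : List (Site 2 × Dir)} {S : List (Site 2)},
      MergeInv m r P t₀ d₀ TD C S → ValidFrom (t₀ + d₀.vec) (TD.map Prod.fst) steps →
      (∀ p ∈ steps, P (newTile p) ∈ tilePolygons m r (newTile p)) →
      MergeInv m r P t₀ d₀ (TD ++ steps.map fun p => (newTile p, p.2.neg)) (C ++ steps)
        (mergeFrom m r P S steps)
  | [], TD, C, S, hI, _, _ => by simpa using hI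
  | p :: rest, TD, C, S, hI, hv, hP => by
    obtain ⟨hp1, hp2, hp3, hv'⟩ := hv
    have hstep := hI.step hp1 hp2 hp3 (hP p (by simp))
    have hv'' : ValidFrom (t₀ + d₀.vec) ((TD ++ [(newTile p, p.2.neg)]).map Prod.fst) rest := by
      simpa using hv'
    have := MergeInv.mergeFrom rest hstep hv'' fun p' hp' => hP p' (by simp [hp'])
    simpa [List.append_assoc] using this

/-- The (tile, entry side) list of the family grown from `(t₀, d₀)` by the steps. [folklore] -/
def entries (t₀ : Site 2) (d₀ : Dir) (steps : List (Site 2 × Dir)) : List (Site 2 × Dir) :=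
  (t₀, d₀) :: steps.map fun p => (newTile p, p.2.neg)

/-- The tiles of `entries` are the tiles after the steps. [folklore] -/
theorem map_fst_entries (t₀ : Site 2) (d₀ : Dir) (steps : List (Site 2 × Dir)) :
    (entries t₀ d₀ steps).map Prod.fst = tilesAfter [t₀] steps := by
  simp [entries, tilesAfter, Function.comp_def]

/-- **The merged excursion satisfies the invariant.** [cite: DuminilCopinKozmaYadin2014, §3 (S_F; proof of the Claim)] -/
theorem MergeInv.mergeList {P : Site 2 → Finset (Sym2 (Site 2))} {t₀ : Site 2} {d₀ : Dir}
    {steps : List (Site 2 × Dir)} (hv : ValidFrom (t₀ + d₀.vec) [t₀] steps)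
    (hP₀ : P t₀ ∈ tilePolygons m r t₀)
    (hP : ∀ p ∈ steps, P (newTile p) ∈ tilePolygons m r (newTile p)) :
    MergeInv m r P t₀ d₀ (entries t₀ d₀ steps) steps (mergeList m r P t₀ d₀ steps) := by
  have := MergeInv.mergeFrom steps (MergeInv.init (d₀ := d₀) hP₀) (by simpa using hv) hP
  simpa [entries, OddTile.mergeList] using this

/-! ### Consequences: region, avoidance of the arena, decoding -/

/-- The vertices of the merged excursion lie in the tiles of the family.
[cite: DuminilCopinKozmaYadin2014, §3 (S_F ⊆ 𝓔_F)] -/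
theorem MergeInv.exists_mem_tile {P : Site 2 → Finset (Sym2 (Site 2))} {t₀ : Site 2} {d₀ : Dir}
    {TD C : List (Site 2 × Dir)} {S : List (Site 2)} (hI : MergeInv m r P t₀ d₀ TD C S) {v : Site 2}
    (hv : v ∈ S) : ∃ τ ∈ TD.map Prod.fst, v ∈ tile m r τ :=
  exists_mem_tile_of_mem_blobRegion hI.connT (hI.saw.subset v hv)

/-- The merged excursion avoids the arena of any tile outside the family.
[cite: DuminilCopinKozmaYadin2014, §3] -/
theorem MergeInv.not_mem_arena {P : Site 2 → Finset (Sym2 (Site 2))} {t₀ : Site 2} {d₀ : Dir}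
    {TD C : List (Site 2 × Dir)} {S : List (Site 2)} (hI : MergeInv m r P t₀ d₀ TD C S)
    {τ₀ : Site 2} (hτ₀ : τ₀ ∉ TD.map Prod.fst) {v : Site 2} (hv : v ∈ S) : v ∉ arena m r τ₀ := by
  intro hva
  have hvR := hI.saw.subset v hv
  rw [mem_blobRegion_iff] at hvR
  rcases hvR with ⟨τ, hτ, hvτ⟩ | ⟨p, hp, hvp⟩
  · exact Finset.disjoint_left.1 (disjoint_innerBox_arena fun h : τ = τ₀ => hτ₀ (h ▸ hτ)) hvτ hva
  · refine Finset.disjoint_left.1 (disjoint_connCells_arena ?_ ?_) hvp hva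
    · exact fun h => hτ₀ (h ▸ (hI.connT p hp).1)
    · exact fun h => hτ₀ (h ▸ (hI.connT p hp).2)

/-- **Decoding**: the polygon of every tile of the family is recovered from the merged list as
the port edge together with the consecutive pairs of its vertices in the inner box ("the
construction is one-to-one"). [cite: DuminilCopinKozmaYadin2014, §3 (proof of the Claim)] -/
theorem MergeInv.eq_insert_pairEdges_filter {P : Site 2 → Finset (Sym2 (Site 2))} {t₀ : Site 2}
    {d₀ : Dir} {TD C : List (Site 2 × Dir)} {S : List (Site 2)} (hI : MergeInv m r P t₀ d₀ TD C S)
    (hPT : ∀ q ∈ TD, P q.1 ∈ tilePolygons m r q.1) {q : Site 2 × Dir} (hq : q ∈ TD) :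
    P q.1 = insert s(portA m r q.1 q.2, portB m r q.1 q.2)
      (pairEdges (S.filter fun v => decide (v ∈ innerBox m r q.1))).toFinset := by
  have h := eq_insert_pairEdges_openList (isPolygon_of_mem_tilePolygons (hPT q hq))
    (port_mem_of_mem_tilePolygons (hPT q hq) q.2)
  rcases hI.filt q hq with hf | hf
  · rw [hf]; exact h
  · rw [hf, pairEdges_reverse_toFinset]; exact h

/-- **The merging construction is one-to-one in the polygons.** [cite: DuminilCopinKozmaYadin2014, §3 (proof of the Claim: "the construction is one-to-one")] -/
theorem mergeList_inj {P P' : Site 2 → Finset (Sym2 (Site 2))} {t₀ : Site 2} {d₀ : Dir}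
    {steps : List (Site 2 × Dir)} (hv : ValidFrom (t₀ + d₀.vec) [t₀] steps)
    (hP : ∀ q ∈ entries t₀ d₀ steps, P q.1 ∈ tilePolygons m r q.1)
    (hP' : ∀ q ∈ entries t₀ d₀ steps, P' q.1 ∈ tilePolygons m r q.1)
    (h : mergeList m r P t₀ d₀ steps = mergeList m r P' t₀ d₀ steps) :
    ∀ q ∈ entries t₀ d₀ steps, P q.1 = P' q.1 := by
  have hmem : ∀ p ∈ steps, (newTile p, p.2.neg) ∈ entries t₀ d₀ steps := fun p hp =>
    List.mem_cons_of_mem _ (List.mem_map_of_mem (f := fun p => (newTile p, p.2.neg)) hp)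
  have h0 : (t₀, d₀) ∈ entries t₀ d₀ steps := List.mem_cons_self
  have hP₀ : P t₀ ∈ tilePolygons m r t₀ := by
    have := hP (t₀, d₀) h0; dsimp only at this; exact this
  have hP₀' : P' t₀ ∈ tilePolygons m r t₀ := by
    have := hP' (t₀, d₀) h0; dsimp only at this; exact this
  have hPs : ∀ p ∈ steps, P (newTile p) ∈ tilePolygons m r (newTile p) := fun p hp => by
    have := hP _ (hmem p hp); dsimp only at this; exact this
  have hPs' : ∀ p ∈ steps, P' (newTile p) ∈ tilePolygons m r (newTile p) := fun p hp => by
    have := hP' _ (hmem p hp); dsimp only at this; exact this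
  have hI := MergeInv.mergeList (P := P) (m := m) (r := r) (d₀ := d₀) hv hP₀ hPs
  have hI' := MergeInv.mergeList (P := P') (m := m) (r := r) (d₀ := d₀) hv hP₀' hPs'
  intro q hq
  have e1 := hI.eq_insert_pairEdges_filter hP hq
  have e2 := hI'.eq_insert_pairEdges_filter hP' hq
  rw [e1, e2, h]

end OddTile

end Literature.Probability.RandomPlanarGeometry.SAW
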